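import Literature.NumberTheory.NumberFields.CyclotomicCharacterIdele
import Literature.NumberTheory.NumberFields.IdelicArtinMapOnRootsOfUnity
import Literature.NumberTheory.NumberFields.IdelicArtinMapRestriction
import Literature.NumberTheory.NumberFields.RayClassFieldsOfRat
import Literature.NumberTheory.GaloisRepresentations.KroneckerWeberTheorem
import HarnessLib

/-!
# Milne, *Complex Multiplication*, Ch. II §9, LEMMA 9.4: `art_ℚ(χ_cyc(σ)) = σ|ℚ^ab`, and the `χ_cyc`-clause of
# LEMMA 9.5: `Nm_{E/ℚ}(s) ∈ χ_cyc(art_E(s)) · ℚ_{>0}`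

Topic `NumberTheory/NumberFields` (global class field theory, idelic dictionary); namespace
`Literature.NumberTheory.NumberFields`.  Lane `lit-hodgefound` (Track 2, Layer A3 skeleton seat `skel-3`, row A3-G40 FILE 2
of 2; FILE 1 = `…NumberFields/CyclotomicCharacterIdele`, the object `χ_cyc`).  THEOREMS ONLY, all proved: no definition, no
named fact, no `sorry`, no new axiom (D-0026, net debt 0).

## The print

J. S. Milne, *Complex Multiplication* (course notes, version of July 14, 2020; open text `paper:url-8ccc30e4daab`, p0076
L25–L40) [MilneCM2006], Ch. II §9 «More preliminaries from algebraic number theory»: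

> «We write art for the reciprocal reciprocity map, i.e., `art_k(s) = rec_k(s)⁻¹` for `s ∈ 𝔸_k`. When `k` is totally
> imaginary, it factors through `𝔸^×_{f,k}` […] then `art_k : 𝔸^×_{f,k} → Gal(k^ab/k)` is surjective with kernel the
> closure of `k^×` (embedded diagonally) in `𝔸^×_{f,k}`.  Let `χ_cyc : Gal(ℚ^al/ℚ) → Ẑ^×` be the cyclotomic character:
> `σζ = ζ^{χ_cyc(σ)}` for all roots `ζ` of `1` in `ℂ`.
> LEMMA 9.4 For any `σ ∈ Gal(ℚ^al/ℚ)`, `art_ℚ(χ_cyc(σ)) = σ|ℚ^ab`.  PROOF. Exercise.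
> LEMMA 9.5 Let `E` be a CM-field. For any `s ∈ 𝔸^×_{f,E}`, `Nm_{E/ℚ}(s) ∈ χ_cyc(art_E(s)) · ℚ_{>0}`.  PROOF. Let
> `σ ∈ Gal(ℚ^al/E)` be such that `art_E(s) = σ|E^ab`. Then `art_ℚ(Nm_{E/ℚ}(s)) = σ|ℚ^ab` by class field theory, and so
> `art_ℚ(Nm_{E/ℚ}(s)) = art_ℚ(χ_cyc(σ))`.  The kernel of `art_ℚ : 𝔸^×_f → Gal(ℚ^ab/ℚ)` is
> `𝔸^×_f ∩ (ℚ^× · ℝ_{>0}) = ℚ_{>0}` (embedded diagonally).»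

The «exercise» is J. Tate, *Global class field theory*, Ch. VII of Cassels–Fröhlich (1967) [CasselsFrohlichANT1967], §5.7
(PDF p. 214): «if `x ∈ C_ℚ` and `x ↦ u` [in `J_ℚ ≅ ℚ^* × ℝ_+^* × ∏_p U_p`] then `ζ^{ψ(x)} = ζ^{u^{-1}}`», which the tree
proves at every finite level `N` (`…NumberFields/IdelicArtinMapOnRootsOfUnity`), assembled over all `N` by the
Kronecker–Weber theorem (the tree's PROVED `KroneckerWeber_holds`).

## Setting (the tree's vocabulary) and the sign convention

`Γ_ℚ = absoluteGaloisGroup ℚ`, `Γ_ℚ^ab = absoluteGaloisGroupAbelianization ℚ` with `absGaloisAbProj ℚ : Γ_ℚ → Γ_ℚ^ab`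
(`σ ↦ σ|ℚ^ab`) and `abRestrict L : Γ_ℚ^ab → G(L|ℚ)` for a finite abelian `L ⊆ ℚ̄`; `χ_cyc = cyclotomicFiniteIdele :
Γ_ℚ →* 𝔸^×_{ℚ,f}` and `cyclotomicIdele σ = (1, χ_cyc σ) ∈ 𝕀_ℚ` (FILE 1); `[·, ℚ] = ideleArtinMap ℚ : 𝕀_ℚ →* Γ_ℚ^ab`
(Shimura's `[x, ℚ]`, the trunk's norm residue symbol: a uniformiser at `p` goes to the ARITHMETIC Frobenius).  THE TREE'S
`[·, ℚ]` IS TATE'S `ψ = rec`; MILNE'S `art = rec⁻¹`.  Hence Milne's «`art_ℚ(χ_cyc(σ)) = σ|ℚ^ab`» reads here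
**`[(1, χ_cyc σ), ℚ] = (σ|ℚ^ab)⁻¹`** — Tate's «`ζ^{ψ(u)} = ζ^{u^{-1}}`» for `u = χ_cyc(σ) ∈ ∏_p U_p`.

## What is proved

* §1 ON THE CYCLOTOMIC LAYERS: for `L = ℚ(μ_N) ⊆ ℚ̄` (`IsCyclotomicExtension {N} ℚ L`),
  `cycloChar_abRestrict_ideleArtinMap_cyclotomicIdele : χ_N([(1, χ_cyc σ), ℚ]|_L) = χ_N(σ|_L)⁻¹` and
  **`abRestrict_ideleArtinMap_cyclotomicIdele : [(1, χ_cyc σ), ℚ]|_L = (σ|_L)⁻¹`** (FILE 1's level-`N` property fed into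
  flt-inv's `cycloChar_abRestrict_ideleArtinMap_rat_of_inv_mul_mem`).
* §2 **LEMMA 9.4 `ideleArtinMap_cyclotomicIdele : [(1, χ_cyc σ), ℚ] = (absGaloisAbProj ℚ σ)⁻¹`** (every finite abelian
  `L ⊆ ℚ̄` lies in some `ℚ(μ_m)` by `KroneckerWeber_holds`, so `γσ` fixes `L` for any lift `γ` of `[(1, χ_cyc σ), ℚ]`, and
  `Γ_ℚ^ab` is separated by the finite abelian layers); corollaries: `ideleArtinMap_cyclotomicIdele_mul_absGaloisAbProj`
  (`[χ_cyc σ, ℚ] · σ|ℚ^ab = 1`), **`ideleArtinMap_units_map_inr_cyclotomicFiniteIdeleAb : [(1, χ_cyc^ab g), ℚ] = g⁻¹`**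
  for every `g ∈ Γ_ℚ^ab` (so `χ_cyc^ab : Gal(ℚ^ab/ℚ) → Ẑ^×` is injective, `cyclotomicFiniteIdeleAb_injective`, and the
  kernel of `χ_cyc` is exactly `closure [Γ_ℚ, Γ_ℚ]`, `ker_cyclotomicFiniteIdele`).
* §3 **LEMMA 9.5, THE `χ_cyc`-CLAUSE, for every number field `k`**
  (`finitePart_ideleRelNorm_mul_cyclotomicIdele_mem_range`): if `τ ∈ Γ_k` lifts `[s, k]` (`absGaloisAbProj k τ =
  ideleArtinMap k s`; Milne's `σ` with `art_E(s) = σ|E^ab` is `τ⁻¹`) then `(Nm_{k/ℚ} s)_𝐡 · χ_cyc(res_{k/ℚ} τ) ∈ ℚ^×`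
  (principal finite idèles) — i.e. «`Nm_{k/ℚ}(s) ∈ χ_cyc(σ) · ℚ^×` on finite parts» with `σ = τ⁻¹`: `res^ab [s, k] =
  [Nm_{k/ℚ} s, ℚ]` (`absGaloisRestrictAb_ideleArtinMap`, Tate VII 4.3 in the limit), LEMMA 9.4, and «the kernel of `art_ℚ`
  on finite parts is `ℚ^×`» (`FiniteIdeleClosure.finitePart_mem_range_of_ideleArtinMap_rat_eq_one`); the coset form
  `exists_finitePart_ideleRelNorm_eq_unitEmbedding_mul_cyclotomicFiniteIdele` (`(Nm s)_𝐡 ∈ ℚ^× · χ_cyc(res τ⁻¹)`).  The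
  sign refinement «`ℚ_{>0}`» concerns the archimedean component only and is NOT asserted here: for a full idèle `s` the
  sign of the rational number is that of `(Nm s)_∞` (DEVIATION, as in A3-G39 FILE 3 (ii); Milne's `s` is a finite idèle,
  `s_∞ = 1`).

NOT HERE: Lemma 9.7's clause (`N_Φ(s) · ι N_Φ(s) ∈ χ_cyc(art_{E*}(s)) · ℚ_{>0}`) — a two-line rider to
`…ComplexMultiplication/ReflexNormArtinMap` ((10) on finite parts + §3 here), filed there to respect the layering; the
surjectivity `χ_cyc(Γ_ℚ) = Ẑ^×` («`Gal(ℚ^ab/ℚ) ≅ Ẑ^×`»).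

## References

* J. S. Milne, *Complex Multiplication* (course notes, 2006; version July 14, 2020), Ch. II §9, Lemmas 9.4, 9.5 (p. 76).
  [MilneCM2006]
* J. Tate, *Global class field theory*, Ch. VII of Cassels–Fröhlich, *Algebraic Number Theory* (1967), §5.7 (PDF p. 214),
  §4 Prop. 4.3 (PDF p. 212). [CasselsFrohlichANT1967]
* J. Neukirch, *Algebraic Number Theory*, Springer 1999, Ch. VI §6 Prop. (6.7) (cyclotomic reciprocity), Ch. IV §1.
  [NeukirchANT1999]
* L. C. Washington, *Introduction to Cyclotomic Fields*, GTM 83, Ch. 14 Thm. 14.1 (Kronecker–Weber). [Washington1997]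

## Provenance

Lane `lit-hodgefound`, seat `literature-prover-lit-hodgefound-skel-3-g26-0` (row A3-G40, FILE 2 of 2).
-/

set_option autoImplicit false

noncomputable section

open NumberField IsDedekindDomain IsDedekindDomain.HeightOneSpectrum Field

open scoped nonZeroDivisors

namespace Literature.NumberTheory.NumberFields

open Literature.NumberTheory.GaloisRepresentations Literature.NumberTheory.AdelicBaseChange

/-! ## §1. On the cyclotomic layers `ℚ(μ_N) ⊆ ℚ̄`: `[(1, χ_cyc σ), ℚ]|_{ℚ(μ_N)} = (σ|_{ℚ(μ_N)})⁻¹` -/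

section Cyclotomic

/- See `…NumberFields/RayClassFieldsOfRat`, «INSTANCES AT `K = ℚ`»: make instance search find the structural `ℚ`-algebra
structures (those of the tree's general-`K` theorems) before `DivisionRing.toRatAlgebra`. -/
attribute [local instance 1001] AlgebraicClosure.instAlgebra IntermediateField.algebra'
  IntermediateField.module'

variable (N : ℕ) [NeZero N] (L : IntermediateField ℚ (AlgebraicClosure ℚ)) [IsCyclotomicExtension {N} ℚ L]
  [FiniteDimensional ℚ L] [IsAbelianGalois ℚ L] [NumberField L]

omit [IsCyclotomicExtension {N} ℚ L] [FiniteDimensional ℚ L] [NumberField L] in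
/-- `σ|_L` acts on `L ⊆ ℚ̄` as `σ` does: `((σ|_L) x : ℚ̄) = σ • x`. [folklore] -/
private theorem coe_absRestrictNormalHom_apply (σ : absoluteGaloisGroup ℚ) (x : L) :
    ((absRestrictNormalHom L σ x : L) : AlgebraicClosure ℚ) = σ • (x : AlgebraicClosure ℚ) :=
  AlgEquiv.restrictNormal_commutes (absoluteGaloisGroup.toAlgEquiv ℚ σ) L x

omit [FiniteDimensional ℚ L] [NumberField L] in
/-- `σ|_L` acts on `ζ_N ∈ L = ℚ(μ_N)` as `σ` does on `ζ_N ∈ ℚ̄`: if `σ • t = t^n` on `μ_N(ℚ̄)` then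
`χ_N(σ|_L) = n mod N`. [cite: MilneCM2006, Ch. II §9, p. 76 («σζ = ζ^{χ_cyc(σ)}»)] -/
theorem cycloChar_absRestrictNormalHom_eq_of_forall_smul_eq_pow (σ : absoluteGaloisGroup ℚ) {n : ℕ}
    (hn : n.Coprime N) (h : ∀ t : AlgebraicClosure ℚ, t ^ N = 1 → σ • t = t ^ n) :
    cycloChar ℚ L N (absRestrictNormalHom L σ) = ZMod.unitOfCoprime n hn := by
  set ζ : L := IsCyclotomicExtension.zeta N ℚ L with hζdef
  have hζ : IsPrimitiveRoot ζ N := IsCyclotomicExtension.zeta_spec N ℚ L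
  -- the primitive root read in `ℚ̄`
  have hz : IsPrimitiveRoot ((ζ : L) : AlgebraicClosure ℚ) N :=
    hζ.map_of_injective (f := algebraMap L (AlgebraicClosure ℚ)) (algebraMap L (AlgebraicClosure ℚ)).injective
  -- `σ • ζ = ζ^n` and `σ • ζ = ζ^{χ_N(σ|_L)}` in `ℚ̄`
  have hσz : σ • ((ζ : L) : AlgebraicClosure ℚ) = ((ζ : L) : AlgebraicClosure ℚ) ^ n := h _ hz.pow_eq_one
  have h1 := congrArg (fun x : L => (x : AlgebraicClosure ℚ)) (cycloChar_spec ℚ L N (absRestrictNormalHom L σ))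
  simp only [coe_absRestrictNormalHom_apply, SubmonoidClass.coe_pow] at h1
  rw [hσz] at h1
  -- `n ≡ χ_N(σ|_L) mod N`
  have hmod : n ≡ ((cycloChar ℚ L N (absRestrictNormalHom L σ) : (ZMod N)ˣ) : ZMod N).val [MOD N] :=
    hz.pow_inj (Nat.mod_lt _ (NeZero.pos N)) (Nat.mod_lt _ (NeZero.pos N))
      (by rw [← pow_eq_pow_mod n hz.pow_eq_one, ← pow_eq_pow_mod _ hz.pow_eq_one]; exact h1)
  refine Units.ext ?_
  rw [ZMod.coe_unitOfCoprime, ← ZMod.natCast_zmod_val (cycloChar ℚ L N (absRestrictNormalHom L σ) : ZMod N),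
    ZMod.natCast_eq_natCast_iff]
  exact hmod.symm

/-- **`χ_N([(1, χ_cyc σ), ℚ]|_{ℚ(μ_N)}) = χ_N(σ|_{ℚ(μ_N)})⁻¹`** — Tate's «`ζ^{ψ(u)} = ζ^{u^{-1}}`» for the unit idèle
`u = (1, χ_cyc σ)`, whose reduction mod `N` is the exponent through which `σ` acts on `μ_N` (FILE 1,
`exists_principalIdele_inv_mul_cyclotomicIdele_mem_congruenceIdeles`; flt-inv's
`cycloChar_abRestrict_ideleArtinMap_rat_of_inv_mul_mem`). [cite: MilneCM2006, Ch. II §9, Lemma 9.4]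
[cite: CasselsFrohlichANT1967, Ch. VII §5.7 (PDF p. 214)] -/
theorem cycloChar_abRestrict_ideleArtinMap_cyclotomicIdele (σ : absoluteGaloisGroup ℚ) :
    cycloChar ℚ L N (abRestrict L (ideleArtinMap ℚ (cyclotomicIdele σ))) =
      (cycloChar ℚ L N (absRestrictNormalHom L σ))⁻¹ := by
  obtain ⟨n, hn0, hn, hact, hmem⟩ := exists_principalIdele_inv_mul_cyclotomicIdele_mem_congruenceIdeles N σ
  rw [cycloChar_abRestrict_ideleArtinMap_rat_of_inv_mul_mem N L (cyclotomicIdele_mem_unitIdeles σ) hn0 hn hmem,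
    cycloChar_absRestrictNormalHom_eq_of_forall_smul_eq_pow N L σ hn hact]

include N in
/-- **`[(1, χ_cyc σ), ℚ]|_{ℚ(μ_N)} = (σ|_{ℚ(μ_N)})⁻¹`** on every cyclotomic layer (the cyclotomic character of `ℚ(μ_N)|ℚ`
is injective). [cite: MilneCM2006, Ch. II §9, Lemma 9.4] [cite: CasselsFrohlichANT1967, Ch. VII §5.7 (PDF p. 214)] -/
theorem abRestrict_ideleArtinMap_cyclotomicIdele (σ : absoluteGaloisGroup ℚ) :
    abRestrict L (ideleArtinMap ℚ (cyclotomicIdele σ)) = (absRestrictNormalHom L σ)⁻¹ :=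
  cycloChar_injective ℚ L N (by rw [map_inv, cycloChar_abRestrict_ideleArtinMap_cyclotomicIdele N L σ])

end Cyclotomic

/-! ## §2. LEMMA 9.4: `[(1, χ_cyc σ), ℚ] = (σ|ℚ^ab)⁻¹` -/

section Lemma94

attribute [local instance 1001] AlgebraicClosure.instAlgebra IntermediateField.algebra'
  IntermediateField.module'

/-- **MILNE CM LEMMA 9.4 («`art_ℚ(χ_cyc(σ)) = σ|ℚ^ab`»), in the tree's convention `[·, ℚ] = rec = art⁻¹`:
`[(1, χ_cyc σ), ℚ] = (σ|ℚ^ab)⁻¹` in `Γ_ℚ^ab = Gal(ℚ^ab/ℚ)`.**  PROOF: by `eq_of_forall_abRestrict_eq` it suffices to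
compare the two sides on every finite abelian `L ⊆ ℚ̄`; by the Kronecker–Weber theorem (`KroneckerWeber_holds`)
`L ⊆ ℚ(μ_m)` for some `m ≥ 1`, and on `ℚ(μ_m)` the two sides agree by §1; restriction from `ℚ(μ_m)` to `L` is read off
pointwise on `ℚ̄`. [cite: MilneCM2006, Ch. II §9, Lemma 9.4] [cite: CasselsFrohlichANT1967, Ch. VII §5.7 (PDF p. 214)]
[cite: Washington1997, Ch. 14, Thm. 14.1] -/
theorem ideleArtinMap_cyclotomicIdele (σ : absoluteGaloisGroup ℚ) :
    ideleArtinMap ℚ (cyclotomicIdele σ) = (absGaloisAbProj ℚ σ)⁻¹ := by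
  -- a lift `γ` of `[(1, χ_cyc σ), ℚ]`
  obtain ⟨γ, hγ⟩ : ∃ γ, absGaloisAbProj ℚ γ = ideleArtinMap ℚ (cyclotomicIdele σ) := QuotientGroup.mk'_surjective _ _
  rw [← hγ, eq_inv_iff_mul_eq_one, ← map_mul]
  refine (QuotientGroup.eq_one_iff _).mpr ((absoluteGaloisGroup.mem_topologicalClosure_commutator_iff ℚ (γ * σ)).mpr ?_)
  intro L _ _
  -- Kronecker–Weber: `L ⊆ M = ℚ(μ_m)`
  obtain ⟨m, hm, hLM⟩ := KroneckerWeber_holds L inferInstance inferInstance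
  haveI : NeZero m := ⟨hm.ne'⟩
  set M : IntermediateField ℚ (AlgebraicClosure ℚ) := IntermediateField.adjoin ℚ {ζ : AlgebraicClosure ℚ | ζ ^ m = 1}
    with hM
  haveI : IsCyclotomicExtension {m} ℚ M := isCyclotomicExtension_adjoin_setOf_pow_eq_one m
  haveI : FiniteDimensional ℚ M := IsCyclotomicExtension.finite {m} ℚ M
  haveI : IsAbelianGalois ℚ M := IsCyclotomicExtension.isAbelianGalois {m} ℚ M
  haveI : NumberField M := NumberField.of_module_finite ℚ M
  -- on `M`: `(γσ)|_M = 1`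
  have hγM : absRestrictNormalHom M (γ * σ) = 1 := by
    rw [map_mul, ← abRestrict_absGaloisAbProj M γ, hγ, abRestrict_ideleArtinMap_cyclotomicIdele m M σ, inv_mul_cancel]
  -- hence `γσ` fixes `L ⊆ M` pointwise
  rw [IntermediateField.mem_fixingSubgroup_iff]
  intro x hx
  have h2 := congrArg (fun τ : M ≃ₐ[ℚ] M => ((τ ⟨x, hLM hx⟩ : M) : AlgebraicClosure ℚ)) hγM
  simp only [AlgEquiv.one_apply] at h2
  rw [coe_absRestrictNormalHom_apply] at h2
  exact h2

/-- `[(1, χ_cyc σ), ℚ] · σ|ℚ^ab = 1`. [cite: MilneCM2006, Ch. II §9, Lemma 9.4] -/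
theorem ideleArtinMap_cyclotomicIdele_mul_absGaloisAbProj (σ : absoluteGaloisGroup ℚ) :
    ideleArtinMap ℚ (cyclotomicIdele σ) * absGaloisAbProj ℚ σ = 1 := by
  rw [ideleArtinMap_cyclotomicIdele, inv_mul_cancel]

/-- LEMMA 9.4 on every finite abelian layer `L ⊆ ℚ̄`: `[(1, χ_cyc σ), ℚ]|_L = (σ|_L)⁻¹`. [cite: MilneCM2006, Ch. II §9, Lemma 9.4] -/
theorem abRestrict_ideleArtinMap_cyclotomicIdele_of_isAbelianGalois (L : IntermediateField ℚ (AlgebraicClosure ℚ))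
    [FiniteDimensional ℚ L] [IsAbelianGalois ℚ L] (σ : absoluteGaloisGroup ℚ) :
    abRestrict L (ideleArtinMap ℚ (cyclotomicIdele σ)) = (absRestrictNormalHom L σ)⁻¹ := by
  rw [ideleArtinMap_cyclotomicIdele, map_inv, abRestrict_absGaloisAbProj]

/-- **LEMMA 9.4 on `Γ_ℚ^ab`: `[(1, χ_cyc^ab g), ℚ] = g⁻¹` for every `g ∈ Gal(ℚ^ab/ℚ)`** — the Artin map composed with the
cyclotomic character is inversion («`art_ℚ ∘ χ_cyc = id`» with `art = rec⁻¹`). [cite: MilneCM2006, Ch. II §9, Lemma 9.4] -/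
theorem ideleArtinMap_units_map_inr_cyclotomicFiniteIdeleAb (g : absoluteGaloisGroupAbelianization ℚ) :
    ideleArtinMap ℚ (Units.map (N := AdeleRing (𝓞 ℚ) ℚ) (MonoidHom.inr (InfiniteAdeleRing ℚ) (FiniteAdeleRing (𝓞 ℚ) ℚ))
      (cyclotomicFiniteIdeleAb g)) = g⁻¹ := by
  obtain ⟨σ, rfl⟩ := QuotientGroup.mk_surjective g
  exact ideleArtinMap_cyclotomicIdele σ

/-- **`χ_cyc^ab : Gal(ℚ^ab/ℚ) → Ẑ^×` is injective** (it has the left inverse `u ↦ [(1, u), ℚ]⁻¹`).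
[cite: MilneCM2006, Ch. II §9, Lemma 9.4] -/
theorem cyclotomicFiniteIdeleAb_injective : Function.Injective cyclotomicFiniteIdeleAb := fun g g' h => by
  rw [← inv_inj, ← ideleArtinMap_units_map_inr_cyclotomicFiniteIdeleAb g,
    ← ideleArtinMap_units_map_inr_cyclotomicFiniteIdeleAb g', h]

/-- **The kernel of `χ_cyc` is exactly `closure [Γ_ℚ, Γ_ℚ] = Gal(ℚ̄/ℚ^ab)`**: `χ_cyc(σ) = 1 ↔ σ|ℚ^ab = 1`.
[cite: MilneCM2006, Ch. II §9, Lemma 9.4] -/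
theorem cyclotomicFiniteIdele_eq_one_iff_absGaloisAbProj_eq_one (σ : absoluteGaloisGroup ℚ) :
    cyclotomicFiniteIdele σ = 1 ↔ absGaloisAbProj ℚ σ = 1 := by
  rw [← cyclotomicFiniteIdeleAb_absGaloisAbProj, ← map_one cyclotomicFiniteIdeleAb]
  exact cyclotomicFiniteIdeleAb_injective.eq_iff

/-- `ker χ_cyc = closure [Γ_ℚ, Γ_ℚ]`. [cite: MilneCM2006, Ch. II §9, Lemma 9.4] -/
theorem ker_cyclotomicFiniteIdele :
    cyclotomicFiniteIdele.ker = (commutator (absoluteGaloisGroup ℚ)).topologicalClosure := by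
  ext σ
  rw [MonoidHom.mem_ker, cyclotomicFiniteIdele_eq_one_iff_absGaloisAbProj_eq_one, ← QuotientGroup.eq_one_iff]
  rfl

/-- `σ` fixes every root of unity iff `σ|ℚ^ab = 1` (every abelian extension of `ℚ` is cyclotomic).
[cite: Washington1997, Ch. 14, Thm. 14.1] [cite: MilneCM2006, Ch. II §9, Lemma 9.4] -/
theorem forall_smul_eq_self_iff_absGaloisAbProj_eq_one (σ : absoluteGaloisGroup ℚ) :
    (∀ (N : ℕ) (t : AlgebraicClosure ℚ), N ≠ 0 → t ^ N = 1 → σ • t = t) ↔ absGaloisAbProj ℚ σ = 1 := by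
  rw [← cyclotomicFiniteIdele_eq_one_iff, cyclotomicFiniteIdele_eq_one_iff_absGaloisAbProj_eq_one]

end Lemma94

/-! ## §3. LEMMA 9.5, the `χ_cyc`-clause: `Nm_{k/ℚ}(s)_𝐡 · χ_cyc(res τ) ∈ ℚ^×` when `τ|k^ab = [s, k]` -/

section Lemma95

variable {k : Type} [Field k] [NumberField k]

/-- **`[Nm_{k/ℚ} s · (1, χ_cyc(res_{k/ℚ} τ)), ℚ] = 1` whenever `τ ∈ Γ_k` lifts `[s, k]`** — «`art_ℚ(Nm_{E/ℚ}(s)) = σ|ℚ^ab`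
by class field theory, and so `art_ℚ(Nm_{E/ℚ}(s)) = art_ℚ(χ_cyc(σ))`» (with `σ = τ⁻¹`: `res^ab [s, k] = [Nm s, ℚ]` by
`absGaloisRestrictAb_ideleArtinMap`, and LEMMA 9.4). [cite: MilneCM2006, Ch. II §9, Lemma 9.5 (proof)]
[cite: CasselsFrohlichANT1967, Ch. VII §4 Prop. 4.3 (PDF p. 212)] -/
theorem ideleArtinMap_ideleRelNorm_mul_cyclotomicIdele_eq_one (s : ideleGroup k) {τ : absoluteGaloisGroup k}
    (hτ : absGaloisAbProj k τ = ideleArtinMap k s) :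
    ideleArtinMap ℚ (ideleRelNorm ℚ k s * cyclotomicIdele (absGaloisRestrict ℚ k τ)) = 1 := by
  rw [map_mul, ideleArtinMap_cyclotomicIdele, ← absGaloisRestrictAb_mk, hτ, absGaloisRestrictAb_ideleArtinMap,
    mul_inv_cancel]

/-- **MILNE CM LEMMA 9.5, the `χ_cyc`-clause, for every number field `k`: `Nm_{k/ℚ}(s)_𝐡 · χ_cyc(res_{k/ℚ} τ) ∈ ℚ^×`**
(a principal finite idèle) whenever `τ ∈ Γ_k` lifts `[s, k] ∈ Γ_k^ab` — i.e. «`Nm_{k/ℚ}(s) ∈ χ_cyc(σ) · ℚ^×`» on finite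
parts with Milne's `σ = τ⁻¹` (`art_k(s) = σ|k^ab ⟺ [s, k] = σ⁻¹|k^ab`).  From `[Nm s · (1, χ_cyc(res τ)), ℚ] = 1` and
«the kernel of `art_ℚ` on finite parts is `ℚ^×`» (`FiniteIdeleClosure.finitePart_mem_range_of_ideleArtinMap_rat_eq_one`).
The sign «`ℚ_{>0}`» lives in the archimedean component `(Nm s)_∞` and is not asserted for a full idèle `s`.
[cite: MilneCM2006, Ch. II §9, Lemma 9.5] -/
theorem finitePart_ideleRelNorm_mul_cyclotomicIdele_mem_range (s : ideleGroup k) {τ : absoluteGaloisGroup k}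
    (hτ : absGaloisAbProj k τ = ideleArtinMap k s) :
    IdeleAction.finitePart ℚ (ideleRelNorm ℚ k s * cyclotomicIdele (absGaloisRestrict ℚ k τ)) ∈
      (FiniteAdeleRing.unitEmbedding (𝓞 ℚ) ℚ).range :=
  FiniteIdeleClosure.finitePart_mem_range_of_ideleArtinMap_rat_eq_one
    (ideleArtinMap_ideleRelNorm_mul_cyclotomicIdele_eq_one s hτ)

/-- The same as a coset statement on finite idèles: `(Nm_{k/ℚ} s)_𝐡 · χ_cyc(res τ) = (q)` for some `q ∈ ℚ^×`, i.e.
**`(Nm_{k/ℚ} s)_𝐡 = (q) · χ_cyc(res τ)⁻¹ = (q) · χ_cyc(res τ⁻¹)`** («`Nm(s) ∈ χ_cyc(σ) · ℚ^×`», `σ = τ⁻¹`).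
[cite: MilneCM2006, Ch. II §9, Lemma 9.5] -/
theorem exists_finitePart_ideleRelNorm_eq_unitEmbedding_mul_cyclotomicFiniteIdele (s : ideleGroup k)
    {τ : absoluteGaloisGroup k} (hτ : absGaloisAbProj k τ = ideleArtinMap k s) :
    ∃ q : ℚˣ, IdeleAction.finitePart ℚ (ideleRelNorm ℚ k s) =
      FiniteAdeleRing.unitEmbedding (𝓞 ℚ) ℚ q * cyclotomicFiniteIdele (absGaloisRestrict ℚ k τ⁻¹) := by
  obtain ⟨q, hq⟩ := finitePart_ideleRelNorm_mul_cyclotomicIdele_mem_range s hτ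
  refine ⟨q, ?_⟩
  rw [map_mul, finitePart_cyclotomicIdele] at hq
  rw [map_inv, map_inv, hq, mul_inv_cancel_right]

end Lemma95

end Literature.NumberTheory.NumberFields
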